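import Summits.CriticalPhenomena.PercolationContinuityZ3.Theorems.PercNearOneGluingNoHeavyQuantSingleMidTerms
import Summits.CriticalPhenomena.PercolationContinuityZ3.Theorems.PercNearOneGluingNoHeavyQuantMidPriceCriterion
import HarnessLib

/-!
# QUANT lane R8, T-DEC: THE MID-PRICE CRITERION FOR A LAW GIVEN BY TERMS, all mids priced (`LawDec.decAtT_of_prices_terms`) — the cell
# interface of the WIDE residue `LightSliceWide` (up to four useful mids; census-2 g60)

builds on p205010 (kernel theorem, internal audit signed; external expert review pending)

Support file (`--supports stmt-CriticalPhenomena-4575`), QUANT lane seat prim-quant-census-2 (gen 60), rung R8 of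
`run/shared/lean/prim/quant/LADDER.md`.  Memo `run/shared/lean/prim/quant/prim-quant-census-2-g60/WIDE-G60.md`.  Theorems only, standard
axioms, no sorries, no definitions.

WHY.  In the wide residue `LawDec.LightSliceWide` (census-2 g59) the light slice — the EIGHT-TERM law `lightSlice_eq_terms` — has up to FOUR
useful mids (`m + l′`, `p + h′`, and `p + h`, `m + l` when they are not a giant / not a conv-low).  `…QuantSingleMidTerms` / `…QuantTwoMidTerms`
fix one / two designated mids; this file restates census-2 g59's full normalised dual `decAtT_of_midPrices` (`…QuantMidPriceCriterion`: prices
`β ≥ 0` on ALL mids, values `α ≤ 1`, `α ≤ usage·β` on compatible low–mid pairs) for a law given by TERMS, so that a cell proof evaluates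
finitely many `if`s at the term positions and may use every mid:
* **`LawDec.decAtT_of_prices_terms`** — floor `0 < x < 1`, target `T`, layer `j`, top `M`; a law `Σ_i c_i δ_{pos_i}` (`c_i ≥ 0`, `Σ c_i = 1`,
  `pos_i ≤ M`).  If for all `α β : ℕ → ℝ` with `β ≥ 0`, `α(pos_i) ≤ 1` on low terms (`pos_i ≤ j ∧ 2pos_i < T`) and
  `α(pos_i) ≤ usage(pos_i, pos_i′)·β(pos_i′)` whenever term `i` is low, term `i′` is a mid (`pos_i′ ≤ j`, `¬ 2pos_i′ < T`) and `T < pos_i + pos_i′`,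
  `Σ_{low terms} c_i α(pos_i) ≤ Σ_{mid terms} β(pos_i) c_i + ((1−x)/x)·(giant mass)`, then the law is `DECAtT x T j M`.

[this work]; LP duality [cite: Schrijver1986, Cor 7.1f (p. 90)] via `…QuantLawDecStrongDuality`.  The gluing rows served
[cite: KozmaNitzan2024, Conjecture 3 (p. 15)]; product measure [cite: Grimmett1999, §1.3 p. 10].
-/

noncomputable section

namespace Summit.CriticalPhenomena.PercolationContinuityZ3.Theorems

namespace Quant

open Finset

namespace LawDec

variable {ι : Type} [Fintype ι]

/-- **THE MID-PRICE CRITERION FOR A LAW GIVEN BY TERMS (all mids priced).**  See the module docstring. [this work] -/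
theorem decAtT_of_prices_terms (x T : ℝ) (j M : ℕ) (c : ι → ℝ) (pos : ι → ℕ) (hx0 : 0 < x) (hx1 : x < 1)
    (hc0 : ∀ i, 0 ≤ c i) (hc1 : ∑ i, c i = 1) (hpos : ∀ i, pos i ≤ M)
    (hdual : ∀ α β : ℕ → ℝ, (∀ h, 0 ≤ β h) →
      (∀ i, pos i ≤ j → 2 * (pos i : ℝ) < T → α (pos i) ≤ 1) →
      (∀ i i', pos i ≤ j → 2 * (pos i : ℝ) < T → pos i' ≤ j → ¬ (2 * (pos i' : ℝ) < T) → T < (pos i : ℝ) + pos i' →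
          α (pos i) ≤ usage x T j (pos i) (pos i') * β (pos i')) →
      ∑ i, (if pos i ≤ j ∧ 2 * (pos i : ℝ) < T then c i * α (pos i) else 0)
        ≤ ∑ i, (if pos i ≤ j ∧ ¬ (2 * (pos i : ℝ) < T) then β (pos i) * c i else 0)
          + ((1 - x) / x) * ∑ i, (if j + 1 ≤ pos i then c i else 0)) :
    DECAtT x T j M (fun q => ∑ i, c i * (if q = pos i then (1 : ℝ) else 0)) := by
  classical
  set μ : ℕ → ℝ := fun q => ∑ i, c i * (if q = pos i then (1 : ℝ) else 0) with hμ
  have hμ0 : ∀ q, 0 ≤ μ q := fun q => Finset.sum_nonneg fun i _ => mul_nonneg (hc0 i) (by split_ifs <;> norm_num)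
  have hμM : ∀ q, M < q → μ q = 0 := by
    intro q hq
    refine Finset.sum_eq_zero fun i _ => ?_
    rw [if_neg (by have := hpos i; omega), mul_zero]
  have hμ1 : ∑ q ∈ Finset.range (M + 1), μ q = 1 := by
    have := sum_range_mul_terms (M + 1) c pos (fun _ => (1 : ℝ))
    simp only [one_mul, mul_one] at this
    rw [this, ← hc1]
    refine Finset.sum_congr rfl fun i _ => ?_
    rw [if_pos (by have := hpos i; omega)]
  have hG : ∑ q ∈ Finset.Ico (j + 1) (M + 1), μ q = ∑ i, (if j + 1 ≤ pos i then c i else 0) := by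
    rw [sum_Ico_terms (j + 1) (M + 1) c pos]
    refine Finset.sum_congr rfl fun i _ => ?_
    by_cases h1 : j + 1 ≤ pos i
    · rw [if_pos ⟨h1, by have := hpos i; omega⟩, if_pos h1]
    · rw [if_neg (by push Not; intro h; exact absurd h h1), if_neg h1]
  refine decAtT_of_midPrices x T j M μ hx0 hx1 hμ0 hμM hμ1 fun α β hβ hα1 hαU => ?_
  -- both sides as sums over the terms
  have eL : ∑ l ∈ Finset.range (j + 1), (if 2 * (l : ℝ) < T then α l * μ l else 0)
      = ∑ l ∈ Finset.range (j + 1), (if 2 * (l : ℝ) < T then α l else 0) * μ l := by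
    refine Finset.sum_congr rfl fun l _ => ?_
    split_ifs <;> simp
  have eR : ∑ h ∈ Finset.range (j + 1), (if 2 * (h : ℝ) < T then 0 else β h * μ h)
      = ∑ h ∈ Finset.range (j + 1), (if 2 * (h : ℝ) < T then 0 else β h) * μ h := by
    refine Finset.sum_congr rfl fun h _ => ?_
    split_ifs <;> simp
  rw [eL, eR, sum_range_mul_terms (j + 1) c pos, sum_range_mul_terms (j + 1) c pos, hG]
  have key := hdual α β hβ (fun i h1 h2 => hα1 (pos i) h1 h2)
    (fun i i' h1 h2 h3 h4 h5 => hαU (pos i) (pos i') h1 h2 h3 (hpos i') h4 h5)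
  have eL2 : ∀ i, (if pos i < j + 1 then c i * (if 2 * (pos i : ℝ) < T then α (pos i) else 0) else 0)
      = (if pos i ≤ j ∧ 2 * (pos i : ℝ) < T then c i * α (pos i) else 0) := by
    intro i
    by_cases h1 : pos i ≤ j
    · by_cases h2 : 2 * (pos i : ℝ) < T
      · rw [if_pos (by omega), if_pos h2, if_pos ⟨h1, h2⟩]
      · rw [if_pos (by omega), if_neg h2, mul_zero, if_neg (fun h => h2 h.2)]
    · rw [if_neg (by omega), if_neg (fun h => h1 h.1)]
  have eR2 : ∀ i, (if pos i < j + 1 then c i * (if 2 * (pos i : ℝ) < T then 0 else β (pos i)) else 0)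
      = (if pos i ≤ j ∧ ¬ (2 * (pos i : ℝ) < T) then β (pos i) * c i else 0) := by
    intro i
    by_cases h1 : pos i ≤ j
    · by_cases h2 : 2 * (pos i : ℝ) < T
      · rw [if_pos (by omega), if_pos h2, mul_zero, if_neg (fun h => h.2 h2)]
      · rw [if_pos (by omega), if_neg h2, if_pos ⟨h1, h2⟩, mul_comm]
    · rw [if_neg (by omega), if_neg (fun h => h1 h.1)]
  simp_rw [eL2, eR2]
  exact key

end LawDec

end Quant

end Summit.CriticalPhenomena.PercolationContinuityZ3.Theorems
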